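import Summits.BirchSwinnertonDyer.BirchSwinnertonDyer.Theorems.ByReductionTypeAtTwoTowerLayerSharp
import HarnessLib

/-!
# The MODULE-FILTRATION certificate, part 1: the duality count `#X/(p, T^m)X = #{s ∈ Sel_∞[p] : (conj_γ−1)^m s = 0}`
# for EVERY `m` (route ByReductionTypeAtTwo, crux `MultUpperHalfAtTwo`, item stmt-BirchSwinnertonDyer-19922;
# seat bsd-2adic-mult-2 GEN 9, part 1 of 3)

HONEST FRAMING (cell `bsd-2adic`, run/shared/lean/pub/bsd-2adic/, HUMAN RULINGS D-0036/D-0054/D-0074): THEOREMS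
ONLY; nothing asserted; no definition; no new named fact; closes nothing by itself; BSD is not proved by any
of this. PARTITION: X5@2 mult (K4ᵐ, B1·O1) × p = 2 — types-the-object-of (a sharper per-class certificate
format for item 19922 AT the class); closes none. bears_on: K4 (route-BirchSwinnertonDyer-ByReductionTypeAtTwo
item 19922).

THE LEVER («σ-lever», seat bsd-2adic-mult-2 GEN 9). Tower-1's chain (`…TowerLayerDuality` → `…TowerLayerLocal`
→ `…TowerLayerGap`) reads the TOWER-GAP certificate `O1.TowerGapAtTwo W` — ONE gap
`#X/(2,T^{m+k})X < 2^k · #X/(2,T^m)X` (T10: then `X` is torsion and `μ = 0`) — off TWO layers at `m = 2^j`,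
`m + k = 2^{j'}`. But T10 allows ANY `m, k`, and for `m ≤ pⁿ` the quotient `X/(p,T^m)X` is ALSO visible at
layer `n`: it is dual to the `p`-torsion classes of `Sel_∞` killed by `(conj_γ − 1)^m`, and those are exactly
the classes of `A_n[p]` killed by `(σ − 1)^m`, `σ = γ|_{K_n}` (`h_n` is injective and `conj`-equivariant when
`E(K)[p] = 0`). So ONE descent at layer `n` recording the action of a generator `σ` of `Gal(K_n/K)` on
`Sel_p(E/K_n)` gives `s(m) = dim_𝔽_p {z ∈ Sel_n[p] : (σ−1)^m z = 0}` for all `m ≤ pⁿ`, and the gap is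
certified as `s(m+k) − s(m) + Σ_n < k` on ANY window `[m, m+k] ⊆ [0, pⁿ]` instead of
`d_{j'} − d_j + Σ_{j'} < p^{j'} − p^j`. In terms of the Jordan blocks `b₁ ≥ b₂ ≥ …` of `T` on `X/pX`
(`Σ bᵢ = λ` when `μ = 0` and `X` has no finite submodule): at `p = 2`, layer `3`, the two-layer certificate
`(0, 3)` needs `λ + Σ₃ ≤ 8`, the window `(7 − Σ₃, Σ₃ + 1)` needs only `b₁ + Σ₃ ≤ 7`.

This part (any number field `K`, prime `p`, `ℤ_p`-extension `κ`, `γ ∈ Γ_K`, dual datum `D`, `X = D.X`):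
* `toDual_X_pow_smul`: `(T^m·x)(s) = x((conj_γ−1)^m s)`; `(p,T^m)X` pairs to zero with the `p`-torsion classes
  killed by `(conj_γ−1)^m` (`toDual_apply_eq_zero_of_mem_towerIdeal_smul_top`); conversely a character killing
  them lies in `(p,T^m)X` (`mem_towerIdeal_smul_top_of_forall_toDual_apply_eq_zero`); hence
  **`natCard_quotient_towerIdeal_eq_natCard_filtration`: `#X/(p,T^m)X = #{s ∈ Sel_∞ : p s = 0, (conj_γ−1)^m s = 0}`**
  (proofs verbatim from tower-1's `…TowerLayerDuality` §1 / the tree's `X1.GeneratorCountLayer`, `ω_n ↦ T^m`).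
* `conjSelmerInfty_pow_apply_eq_self_of_filtration`: such a class is fixed by `conj_{γ^{pⁿ}}` when `m ≤ pⁿ`
  (`(1+T)^{pⁿ} = 1 + T^{pⁿ} + p·c` in `Λ`, read through the pairing) — the bridge to the layer (part 2).

References: R. Greenberg, LNM 1716 (1999), §1 p. 60 (`X/𝔪X` dual to `Sel[𝔪]`, the `Λ`-action through `Γ`),
§3 pp. 85–90 (Lemmas 3.1–3.5); L. Washington, *Introduction to Cyclotomic Fields*, §13.1–13.2 (`ω_n`,
Lemma 13.16); J.-P. Serre, *Galois Cohomology*, I.§2.5.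
-/
set_option autoImplicit false
-- the Theorems namespace of this sub repeats the summit name by design (D-0017 nested layout: Summit.<S>.<Sub>)
set_option linter.dupNamespace false

noncomputable section

open scoped Classical

open NumberField IsDedekindDomain WeierstrassCurve Literature.NumberTheory.EllipticCurves
  Literature.NumberTheory.EllipticCurves.IwasawaDual PowerSeries Summit.BirchSwinnertonDyer.Rank1Residual
  Summit.BirchSwinnertonDyer.Rank1Residual.X5.TowerGap Summit.BirchSwinnertonDyer.Rank1Residual.X5.O1

universe u

namespace Summit.BirchSwinnertonDyer.BirchSwinnertonDyer.Theorems.TowerFiltration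
/-! ## §1 The pairing at `(p, T^m)` -/

section Pairing

variable {K : Type u} [Field K] [NumberField K] {W : WeierstrassCurve K} {p : ℕ} [hp : Fact p.Prime]
  {κ : ZpExtension K p} {γ : Field.absoluteGaloisGroup K} (D : W.SelmerDualData κ γ)

/-- `((conj_γ − 1) s)` is `conj_γ s − s` (coercion to `H¹(K_∞, E[p^∞])`). [folklore] -/
theorem coe_conjSelmerInfty_sub_one_apply (s : W.selmerInfty κ) :
    (((W.conjSelmerInfty κ γ - 1) s : W.selmerInfty κ) : W.subgroupH1 p κ.kerSubgroup) =
      W.conjH1 p κ.kerSubgroup γ s - s := by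
  rfl

/-- **`(T·x)(s) = x((conj_γ − 1) s)`** (the datum's `toDual_T_smul`). [cite: GreenbergLNM1716, §1 p. 60] -/
theorem toDual_X_smul (x : D.X) (s : W.selmerInfty κ) :
    D.toDual ((X : IwasawaAlgebra p) • x) s = D.toDual x ((W.conjSelmerInfty κ γ - 1) s) := by
  rw [D.toDual_T_smul, ← map_sub]
  rfl

/-- **`(T^m·x)(s) = x((conj_γ − 1)^m s)`** for every `m`. [cite: GreenbergLNM1716, §1 p. 60] -/
theorem toDual_X_pow_smul (m : ℕ) :
    ∀ (x : D.X) (s : W.selmerInfty κ),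
      D.toDual ((X : IwasawaAlgebra p) ^ m • x) s =
        D.toDual x (((W.conjSelmerInfty κ γ - 1) ^ m) s) := by
  induction m with
  | zero => intro x s; rw [pow_zero, one_smul, pow_zero, AddMonoid.End.one_apply]
  | succ m ih =>
    intro x s
    rw [pow_succ, mul_smul, ih, toDual_X_smul, pow_succ', AddMonoid.End.coe_mul, Function.comp_apply]

/-- **`(p, T^m)X` pairs to zero with every `p`-torsion class killed by `(conj_γ − 1)^m`.**
[cite: GreenbergLNM1716, §1 p. 60] -/
theorem toDual_apply_eq_zero_of_mem_towerIdeal_smul_top (m : ℕ) {x : D.X}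
    (hx : x ∈ (towerIdeal p m • ⊤ : Submodule (IwasawaAlgebra p) D.X))
    (s : W.selmerInfty κ) (hps : p • s = 0) (hνs : ((W.conjSelmerInfty κ γ - 1) ^ m) s = 0) :
    D.toDual x s = 0 := by
  rw [towerIdeal_eq_span_pair] at hx
  refine Submodule.smul_induction_on hx (fun r hr y _ ↦ ?_) (fun y z hy hz ↦ ?_)
  · obtain ⟨u, v, rfl⟩ := Ideal.mem_span_pair.mp hr
    rw [add_smul, map_add, AddMonoidHom.add_apply, mul_comm u, mul_comm v, mul_smul, mul_smul,
      X1.GeneratorCountLayer.toDual_C_p_smul_eq_zero D (u • y) s hps, toDual_X_pow_smul D m (v • y) s,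
      hνs, map_zero, add_zero]
  · rw [map_add, AddMonoidHom.add_apply, hy, hz, add_zero]

/-- **The Pontryagin step at `(p, T^m)` (upper half of the duality).** If the character `toDual x` kills
every `p`-torsion class `s ∈ Sel_∞` with `(conj_γ − 1)^m s = 0`, then `x ∈ (p, T^m)X`: the character kills
`ker (s ↦ (p·s, (conj_γ−1)^m s))`, factors through the image in `S × S`, extends to `S × S` (injectivity of
`ℚ/ℤ`) as `(y₁, y₂)`, and with `yᵢ = toDual xᵢ` one gets `x = p·x₁ + T^m·x₂`. Verbatim from tower-1's
`mem_layerIdeal_smul_top_of_forall_toDual_apply_eq_zero` with `ω_n` replaced by `T^m`.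
[cite: GreenbergLNM1716, §1 p. 60] -/
theorem mem_towerIdeal_smul_top_of_forall_toDual_apply_eq_zero (m : ℕ) {x : D.X}
    (hx : ∀ s : W.selmerInfty κ, p • s = 0 →
      ((W.conjSelmerInfty κ γ - 1) ^ m) s = 0 → D.toDual x s = 0) :
    x ∈ (towerIdeal p m • ⊤ : Submodule (IwasawaAlgebra p) D.X) := by
  let φ : ↥(W.selmerInfty κ) →+ ↥(W.selmerInfty κ) :=
    ((W.conjSelmerInfty κ γ - 1 : AddMonoid.End (W.selmerInfty κ)) ^ m)
  let δ : ↥(W.selmerInfty κ) →+ ↥(W.selmerInfty κ) × ↥(W.selmerInfty κ) :=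
    (DistribSMul.toAddMonoidHom _ p).prod φ
  have hδ : ∀ s, δ s = (p • s, φ s) := fun s ↦ rfl
  have hker : δ.rangeRestrict.ker ≤ (D.toDual x).ker := by
    intro s hs
    rw [AddMonoidHom.mem_ker] at hs ⊢
    have hs' : δ s = 0 := congrArg (fun z : δ.range ↦ (z : ↥(W.selmerInfty κ) × ↥(W.selmerInfty κ))) hs
    rw [hδ, Prod.mk_eq_zero] at hs'
    exact hx s hs'.1 hs'.2
  have hsurj : Function.Surjective δ.rangeRestrict := AddMonoidHom.rangeRestrict_surjective δ
  let χ' : δ.range →+ AddCircle (1 : ℚ) := δ.rangeRestrict.liftOfSurjective hsurj ⟨D.toDual x, hker⟩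
  have hχ' : ∀ s, χ' (δ.rangeRestrict s) = D.toDual x s := fun s ↦
    AddMonoidHom.liftOfRightInverse_comp_apply _ _ _ _ s
  obtain ⟨y, hy⟩ := CharacterModule.dual_surjective_of_injective
    (δ.range.subtype.toIntLinearMap) (fun a b hab ↦ Subtype.ext hab) χ'
  have hy' : ∀ g : δ.range, y g = χ' g := fun g ↦ by
    have := DFunLike.congr_fun hy g
    rw [CharacterModule.dual_apply] at this
    exact this
  let y₀ : ↥(W.selmerInfty κ) × ↥(W.selmerInfty κ) →+ AddCircle (1 : ℚ) := y
  let y₁ : ↥(W.selmerInfty κ) →+ AddCircle (1 : ℚ) := y₀.comp (AddMonoidHom.inl _ _)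
  let y₂ : ↥(W.selmerInfty κ) →+ AddCircle (1 : ℚ) := y₀.comp (AddMonoidHom.inr _ _)
  have hsplit : ∀ s, D.toDual x s = y₁ (p • s) + y₂ (φ s) := by
    intro s
    have e1 : D.toDual x s = y₀ ((δ.rangeRestrict s : δ.range) : _ × _) := by
      rw [← hχ' s, ← hy']
      rfl
    rw [e1]
    change y₀ (δ s) = y₀ (p • s, 0) + y₀ (0, φ s)
    rw [← map_add, Prod.mk_add_mk, add_zero, zero_add, hδ]
  obtain ⟨x₁, hx₁⟩ := D.bijective.2 y₁
  obtain ⟨x₂, hx₂⟩ := D.bijective.2 y₂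
  have hx12 : x = (C (p : ℤ_[p]) : IwasawaAlgebra p) • x₁ + (X : IwasawaAlgebra p) ^ m • x₂ := by
    apply D.bijective.1
    ext s
    rw [map_add, AddMonoidHom.add_apply, TowerLayer.toDual_C_natCast_smul_apply, toDual_X_pow_smul,
      hx₁, hx₂, hsplit]
    rfl
  rw [hx12, towerIdeal_eq_span_pair]
  exact Submodule.add_mem _ (Submodule.smul_mem_smul (Ideal.subset_span (by simp)) Submodule.mem_top)
    (Submodule.smul_mem_smul (Ideal.subset_span (by simp)) Submodule.mem_top)

/-- **`#{p`-torsion classes killed by `(conj_γ−1)^m} ≤ #X/(p,T^m)X` for finite families**: `s ↦ (x ↦ x(s))`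
is injective into `Hom(X/(p,T^m)X, ℚ/ℤ)` (characters separate classes) and `#Hom(Q, ℚ/ℤ) = #Q` for the finite
group `Q = X/(p,T^m)X` (`finite_quotient_towerIdeal`). [cite: GreenbergLNM1716, §1 p. 60] -/
theorem card_le_natCard_quotient_towerIdeal [Module.Finite (IwasawaAlgebra p) D.X] (m : ℕ)
    (t : Finset (W.selmerInfty κ))
    (ht : ∀ s ∈ t, p • s = 0 ∧ ((W.conjSelmerInfty κ γ - 1) ^ m) s = 0) :
    t.card ≤ Nat.card (D.X ⧸ (towerIdeal p m • ⊤ : Submodule (IwasawaAlgebra p) D.X)) := by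
  set N : Submodule (IwasawaAlgebra p) D.X := towerIdeal p m • ⊤ with hN
  haveI : Finite (D.X ⧸ N) := finite_quotient_towerIdeal p m
  haveI : Finite (CharacterModule (D.X ⧸ N)) :=
    PontryaginCard.finite_characterModule_of_finite (D.X ⧸ N)
  let f : t → CharacterModule (D.X ⧸ N) := fun s ↦
    QuotientAddGroup.lift N.toAddSubgroup (D.toDual.flip s.1) fun x hx ↦ by
      simpa using toDual_apply_eq_zero_of_mem_towerIdeal_smul_top D m hx s.1 (ht s.1 s.2).1
        (ht s.1 s.2).2
  have hf_mk : ∀ (s : t) (x : D.X), f s (Submodule.Quotient.mk x) = D.toDual x s.1 := fun _ _ ↦ rfl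
  have hf : Function.Injective f := by
    rintro ⟨s, hs⟩ ⟨s', hs'⟩ h
    refine Subtype.ext (X1.GeneratorCountLayerZero.eq_of_forall_toDual_apply_eq D fun x ↦ ?_)
    rw [← hf_mk ⟨s, hs⟩ x, ← hf_mk ⟨s', hs'⟩ x, h]
  calc t.card = Nat.card t := (Nat.card_eq_finsetCard t).symm
    _ ≤ Nat.card (CharacterModule (D.X ⧸ N)) := Nat.card_le_card_of_injective f hf
    _ = Nat.card (D.X ⧸ N) := PontryaginCard.natCard_characterModule_of_finite _

/-- **The filtered pieces `{s ∈ Sel_∞ : p s = 0, (conj_γ−1)^m s = 0}` are finite** when `X` is finitely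
generated (counted by the finite group `X/(p,T^m)X`). [cite: GreenbergLNM1716, §1 p. 60] -/
theorem finite_filtrationPTorsion [Module.Finite (IwasawaAlgebra p) D.X] (m : ℕ) :
    Finite {s : W.selmerInfty κ // p • s = 0 ∧ ((W.conjSelmerInfty κ γ - 1) ^ m) s = 0} := by
  by_contra hinf
  rw [not_finite_iff_infinite] at hinf
  set N := Nat.card (D.X ⧸ (towerIdeal p m • ⊤ : Submodule (IwasawaAlgebra p) D.X)) with hN
  obtain ⟨t, ht⟩ := Infinite.exists_subset_card_eq
    {s : W.selmerInfty κ // p • s = 0 ∧ ((W.conjSelmerInfty κ γ - 1) ^ m) s = 0} (N + 1)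
  have hle := card_le_natCard_quotient_towerIdeal D m (t.map (Function.Embedding.subtype _))
    fun s hs ↦ by
      obtain ⟨z, -, rfl⟩ := Finset.mem_map.mp hs
      exact z.2
  rw [Finset.card_map, ht] at hle
  omega

/-- **The duality count at `(p, T^m)` (EQUALITY): `#X/(p,T^m)X = #{s ∈ Sel_∞ : p·s = 0, (conj_γ−1)^m s = 0}`**
for every dual datum `D` over `(κ, γ)` with `X = D.X` finitely generated (any `ℤ_p`-extension, any `γ`, any
`m`). `≥`: the pairing; `≤`: `x mod (p,T^m)X ↦ (s ↦ x(s))` is injective into the character group of that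
finite piece. The case `m = pⁿ` is tower-1's `natCard_quotient_layerIdeal_eq` (`(p, ω_n) = (p, T^{pⁿ})`).
[cite: GreenbergLNM1716, §1 p. 60] -/
theorem natCard_quotient_towerIdeal_eq_natCard_filtration [Module.Finite (IwasawaAlgebra p) D.X] (m : ℕ) :
    Nat.card (D.X ⧸ (towerIdeal p m • ⊤ : Submodule (IwasawaAlgebra p) D.X)) =
      Nat.card {s : W.selmerInfty κ // p • s = 0 ∧ ((W.conjSelmerInfty κ γ - 1) ^ m) s = 0} := by
  haveI hfin := finite_filtrationPTorsion D m
  set N : Submodule (IwasawaAlgebra p) D.X := towerIdeal p m • ⊤ with hN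
  haveI : Finite (D.X ⧸ N) := finite_quotient_towerIdeal p m
  -- the subgroup `T = Sel_∞[p][(conj_γ−1)^m]`
  let T : AddSubgroup (W.selmerInfty κ) :=
    (AddSubgroup.torsionBy (W.selmerInfty κ) (p : ℤ)) ⊓ ((W.conjSelmerInfty κ γ - 1) ^ m).ker
  have hTmem : ∀ s : W.selmerInfty κ, s ∈ T ↔ p • s = 0 ∧ ((W.conjSelmerInfty κ γ - 1) ^ m) s = 0 :=
    fun s ↦ by
      rw [AddSubgroup.mem_inf, AddMonoidHom.mem_ker]
      exact and_congr_left fun _ ↦ AddSubgroup.torsionBy.nsmul_iff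
  let eT : T ≃ {s : W.selmerInfty κ // p • s = 0 ∧ ((W.conjSelmerInfty κ γ - 1) ^ m) s = 0} :=
    Equiv.subtypeEquivRight hTmem
  haveI : Finite T := Finite.of_equiv _ eT.symm
  apply le_antisymm
  · -- `≤`: `X/N ↪ Hom(T, ℚ/ℤ)`
    haveI : Finite (CharacterModule T) := PontryaginCard.finite_characterModule_of_finite T
    let res : (↥(W.selmerInfty κ) →+ AddCircle (1 : ℚ)) →+ CharacterModule T :=
      { toFun := fun f ↦ f.comp T.subtype
        map_zero' := rfl
        map_add' := fun _ _ ↦ rfl }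
    let f : D.X →+ CharacterModule T := res.comp D.toDual
    have hf : ∀ (x : D.X) (s : T), f x s = D.toDual x s := fun _ _ ↦ rfl
    have hfN : ∀ x ∈ N.toAddSubgroup, f x = 0 := by
      intro x hx
      ext s
      rw [hf]
      exact toDual_apply_eq_zero_of_mem_towerIdeal_smul_top D m hx s ((hTmem s).mp s.2).1
        ((hTmem s).mp s.2).2
    let Φ : D.X ⧸ N → CharacterModule T := fun q ↦ QuotientAddGroup.lift N.toAddSubgroup f hfN q
    have hΦ_mk : ∀ x : D.X, Φ (Submodule.Quotient.mk x) = f x := fun _ ↦ rfl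
    have hΦ : Function.Injective Φ := by
      intro q q'
      induction q using Submodule.Quotient.induction_on with | _ x => ?_
      induction q' using Submodule.Quotient.induction_on with | _ x' => ?_
      intro h
      rw [hΦ_mk, hΦ_mk] at h
      rw [Submodule.Quotient.eq]
      refine mem_towerIdeal_smul_top_of_forall_toDual_apply_eq_zero D m fun s hs hs' ↦ ?_
      have := DFunLike.congr_fun h ⟨s, (hTmem s).mpr ⟨hs, hs'⟩⟩
      rw [hf, hf] at this
      rw [map_sub, AddMonoidHom.sub_apply, this, sub_self]
    calc Nat.card (D.X ⧸ N) ≤ Nat.card (CharacterModule T) := Nat.card_le_card_of_injective Φ hΦ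
      _ = Nat.card T := PontryaginCard.natCard_characterModule_of_finite T
      _ = _ := Nat.card_congr eT
  · -- `≥`: the pairing
    haveI := Fintype.ofFinite {s : W.selmerInfty κ // p • s = 0 ∧ ((W.conjSelmerInfty κ γ - 1) ^ m) s = 0}
    have hle := card_le_natCard_quotient_towerIdeal D m
      ((Finset.univ : Finset {s : W.selmerInfty κ //
        p • s = 0 ∧ ((W.conjSelmerInfty κ γ - 1) ^ m) s = 0}).map (Function.Embedding.subtype _))
      fun s hs ↦ by
        obtain ⟨z, -, rfl⟩ := Finset.mem_map.mp hs
        exact z.2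
    rwa [Finset.card_map, Finset.card_univ, ← Nat.card_eq_fintype_card] at hle


/-- **A `p`-torsion class killed by `(conj_γ − 1)^m`, `m ≤ pⁿ`, is fixed by `conj_{γ^{pⁿ}}`** — through the
duality (given a dual datum `D`): for every `x ∈ X`, `x(conj_γ^{pⁿ} s) = ((1+T)^{pⁿ}·x)(s)`
(`toDual_one_add_X_pow_smul`) and `(1+T)^{pⁿ} = 1 + T^{pⁿ} + p·c` (`C_p_dvd_omega_sub_X_pow`), so
`x(conj_γ^{pⁿ} s) = x(s) + x((conj_γ−1)^{pⁿ} s) + (c·x)(p·s) = x(s)`; characters separate classes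
(`eq_of_forall_toDual_apply_eq`). This is `(1+ν)^{pⁿ} ≡ 1 + ν^{pⁿ} (mod p)` read through `Λ`.
[cite: Washington1997, §13.2 (Lemma 13.15 ff.)] -/
theorem conjSelmerInfty_pow_apply_eq_self_of_filtration (D : W.SelmerDualData κ γ) (n : ℕ) {m : ℕ}
    (hm : m ≤ p ^ n) (s : W.selmerInfty κ) (hps : p • s = 0)
    (hν : ((W.conjSelmerInfty κ γ - 1 : AddMonoid.End (W.selmerInfty κ)) ^ m) s = 0) :
    ((W.conjSelmerInfty κ γ) ^ p ^ n) s = s := by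
  have hνN : ((W.conjSelmerInfty κ γ - 1 : AddMonoid.End (W.selmerInfty κ)) ^ p ^ n) s = 0 := by
    rw [← Nat.sub_add_cancel hm, pow_add, AddMonoid.End.coe_mul, Function.comp_apply, hν, map_zero]
  refine X1.GeneratorCountLayerZero.eq_of_forall_toDual_apply_eq D fun x ↦ ?_
  rw [← X1.GeneratorCountLayer.toDual_one_add_X_pow_smul D (p ^ n) x s]
  obtain ⟨c, hc⟩ := X1.GeneratorCountLayer.C_p_dvd_omega_sub_X_pow (p := p) n
  have h1 : ((1 + (X : IwasawaAlgebra p)) ^ p ^ n) =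
      1 + ((X : IwasawaAlgebra p) ^ p ^ n + (C (p : ℤ_[p]) : IwasawaAlgebra p) * c) := by
    rw [← hc]; ring
  rw [h1, add_smul, one_smul, map_add, AddMonoidHom.add_apply, add_smul, map_add,
    AddMonoidHom.add_apply, toDual_X_pow_smul D, hνN, map_zero, zero_add, mul_smul,
    X1.GeneratorCountLayer.toDual_C_p_smul_eq_zero D (c • x) s hps, add_zero]

/-- The `End`-power `(conj_γ − 1)^k` on `Sel_∞` is the `k`-th iterate of `conj_γ − id` on `H¹(K_∞, E[p^∞])`.
[folklore] -/
theorem coe_conjSelmerInfty_sub_one_pow_apply (k : ℕ) :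
    ∀ s : W.selmerInfty κ,
      ((((W.conjSelmerInfty κ γ - 1 : AddMonoid.End (W.selmerInfty κ)) ^ k) s : W.selmerInfty κ) :
        W.subgroupH1 p κ.kerSubgroup) =
      (⇑(W.conjH1 p κ.kerSubgroup γ - AddMonoidHom.id (W.subgroupH1 p κ.kerSubgroup)))^[k] (s : W.subgroupH1 p κ.kerSubgroup) := by
  induction k with
  | zero => intro s; rw [pow_zero, AddMonoid.End.one_apply, Function.iterate_zero, id]
  | succ k ih =>
    intro s
    rw [pow_succ, AddMonoid.End.coe_mul, Function.comp_apply, Function.iterate_succ_apply, ih]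
    rfl

end Pairing

end Summit.BirchSwinnertonDyer.BirchSwinnertonDyer.Theorems.TowerFiltration

end
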